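import Summits.RiemannHypothesis.RiemannHypothesis.Theses.ShiftedResolvent
import Literature.NumberTheory.LFunctions.WeilResolventVectorExists
import Literature.NumberTheory.LFunctions.WeilGroundEnergyParitySplit
import Literature.NumberTheory.LFunctions.WeilGroundEnergyProofs
import Literature.NumberTheory.LFunctions.WeilGroundState
import Literature.NumberTheory.LFunctions.WeilMellinBounds
import Literature.NumberTheory.LFunctions.WeilCriterion
import Literature.NumberTheory.LFunctions.WeilCriterionProofs
import HarnessLib

/-!
# COSTUME — crux `ResolventConvergence` (stmt-RiemannHypothesis-15968) is the summit in costume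

Redirect strategist r1 (`planner-cstrat-stmt-RiemannHypothesis-15968-r1-0`, 2026-08-17), route
`ShiftedResolvent` (flagged `judge-flags(smuggling; attack=2)`). Kernel-checked, sorry-free.

## Theorem A (the decl AS TYPED): `ResolventConvergence → Summit.RiemannHypothesis`, thesis unused

`riemannHypothesis_of_resolventConvergence`. The proof uses ONLY: `a_k → ∞`, `0 < a_k`, and the
sub-clause "the inline (mis-parsed, see `MISSTATED.md`) Dirichlet functional is bounded below on the
window test functions" of the fourth conjunct. The shift condition `lam_k < ε(a_k)`, the vectors
`v_k`, the constants `c_k`, the locally uniform convergence, the non-vanishing of the limit and the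
`ξ`-vanishing clause are ALL UNUSED (`riemannHypothesis_of_typedLowerBounds`). Mechanism: because
the `∫` binder swallows `- 2 * (weilMellin h (1/2)).re`, the typed functional equals `Re Q(h)` on
every test `h` with `Re ĥ(1/2) ≠ 0` (junk integral); if `ε(a) < 0` a window test with `Re Q < 0`
can be perturbed to have `Re ĥ(1/2) ≠ 0` and scaled, so the typed functional is unbounded below —
hence a typed lower bound at `(a_k)` forces `ε(a_k) ≥ 0`; `a_k → ∞` and antitonicity of `ε` give
`ε ≥ 0` on `(0, ∞)`, i.e. Weil positivity on every window, i.e. RH (Yoshida/Weil criterion,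
`weil_criterion_holds`). So the typed crux is AT LEAST the summit (certified `C → S`), through a
side door that has nothing to do with shifted resolvents.

## Theorem A′ (NEGATION side, typed decl): `ResolventConvergence → ∃ a₀ > 0, ∀ b ≥ a₀, ε(b) = 0`

`weilGroundEnergy_eventually_eq_zero_of_resolventConvergence` (+ `resolventConvergence_typed_forces :
ResolventConvergence → RH ∧ (ε ≡ 0 on a tail)`). On a window with `ε(a) > 0` every TYPED resolvent
vector is `0` a.e. (`typed_integral_norm_sq_eq_zero`, any admissible shift), so `ε > 0` on the ray
would make every `c_k v̂_k ≡ 0` and the limit `F ≡ 0` on `U⁺`. Under RH `ε(a) > 0 ∀ a` is the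
expected (published-input) situation, so the typed decl is false modulo that input — MISSTATED.md §2,
now kernel-checked up to the sampling input.

## Theorem B (the REPAIRED decl, restate menu R1 of `MISSTATED.md`):
`ResolventRealZerosR → (ResolventConvergenceR ↔ Summit.RiemannHypothesis ∧ NonCollapseR)`

`resolventConvergenceR_iff`. Here `NonCollapseR` is the crux with its last clause ("`F` vanishes at
every zero of `ξ` in `U⁺`") DELETED. Under RH that clause is VACUOUS (no zeros of `ξ` in `U⁺`,
`resolventConvergenceR_of_riemannHypothesis`); without RH it is what `closes` converts into RH by
Hurwitz (`riemannHypothesis_of_resolventConvergenceR`, the route's proof script verbatim). So the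
repaired crux is the CONJUNCTION of the summit with an open side statement `NonCollapseR` (itself
only conjectural in print even under RH: CCM arXiv:2511.22755 (1.2), Suzuki arXiv:2606.09096 Cor. 1.6)
— strictly summit-or-stronger, and its excess over `NonCollapseR` is exactly the bit "RH".
-/

set_option linter.style.longLine false
set_option linter.unusedVariables false
set_option linter.dupNamespace false

noncomputable section

namespace Summit.RiemannHypothesis.RiemannHypothesis.Cruxes.ResolventConvergence.Costume

open Filter Set MeasureTheory
open scoped Topology ComplexConjugate
open Literature.NumberTheory.LFunctions
open Literature.NumberTheory.LFunctions.ConnesVanSuijlekom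
open Summit.RiemannHypothesis.RiemannHypothesis.Theses.ShiftedResolvent (ResolventConvergence)

/-! ## §1 The typed functional and its collapse (cf. `Lines/birth.lean` §5) -/

/-- The inline "Dirichlet functional" AS TYPED in the route file (the `∫` binder swallows the
trailing `- 2 * (weilMellin h (1 / 2)).re`). [folklore] -/
def typedJ (lam : ℝ) (h : ℝ → ℂ) : ℝ :=
  (weilQuadratic h).re - lam * ∫ t, ‖h t‖ ^ 2 - 2 * (weilMellin h (1 / 2)).re

/-- What the typed text denotes (`rfl`): `Re Q(h) − λ ∫ (|h(t)|² − 2 Re ĥ(1/2)) dt`. [folklore] -/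
theorem typedJ_eq (lam : ℝ) (h : ℝ → ℂ) :
    typedJ lam h = (weilQuadratic h).re - lam * ∫ t, (‖h t‖ ^ 2 - 2 * (weilMellin h (1 / 2)).re) :=
  rfl

/-- Lebesgue measure on `ℝ` is not finite. [folklore] -/
theorem not_isFiniteMeasure_volume_real : ¬ IsFiniteMeasure (volume : Measure ℝ) := by
  intro hfin
  have h := measure_lt_top (volume : Measure ℝ) (univ : Set ℝ)
  rw [Real.volume_univ] at h
  exact lt_irrefl _ h

/-- For a test function `h` with `Re ĥ(1/2) ≠ 0` the swallowed integrand is not integrable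
(a non-zero constant is not integrable on `ℝ`). [folklore] -/
theorem not_integrable_swallowed {h : ℝ → ℂ} (hh : IsWeilTest h)
    (hne : (weilMellin h (1 / 2)).re ≠ 0) :
    ¬ Integrable (fun t : ℝ => ‖h t‖ ^ 2 - 2 * (weilMellin h (1 / 2)).re) := by
  intro hi
  have hconst : Integrable (fun _ : ℝ => 2 * (weilMellin h (1 / 2)).re) := by
    refine (hh.integrable_norm_sq.sub hi).congr (Eventually.of_forall fun t => ?_)
    simp only [Pi.sub_apply, sub_sub_cancel]
  rcases integrable_const_iff.1 hconst with h0 | hfin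
  · exact hne (by linarith)
  · exact not_isFiniteMeasure_volume_real hfin

/-- **Collapse**: for a test function with `Re ĥ(1/2) ≠ 0` the typed functional is `Re Q(h)`,
WHATEVER the shift `λ` (junk value `0` of the Bochner integral). [folklore] -/
theorem typedJ_eq_re_weilQuadratic {lam : ℝ} {h : ℝ → ℂ} (hh : IsWeilTest h)
    (hne : (weilMellin h (1 / 2)).re ≠ 0) : typedJ lam h = (weilQuadratic h).re := by
  rw [typedJ_eq, integral_undef (not_integrable_swallowed hh hne), mul_zero, sub_zero]

/-! ## §2 A typed lower bound forces `ε(a) ≥ 0` -/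

section Key

variable {a : ℝ}

/-- **Perturbation.** On a window `[-a, a]`, `a > 0`, a test function with `Re Q < 0` can be
replaced by one with `Re Q < 0` AND `Re ĥ(1/2) ≠ 0`: if `Re ĥ₀(1/2) = 0`, add `t φ` for a window
test `φ` with `φ̂(1/2) > 0` (`exists_isWeilTest_weilMellin_ne_zero`, phase-turned) and `t > 0`
small (`Re Q(h₀ + t φ)` is a real quadratic polynomial in `t`, `re_weilQuadratic_add_real_mul`). [folklore] -/
theorem exists_re_weilQuadratic_neg_and_re_weilMellin_ne_zero (ha : 0 < a) {h₀ : ℝ → ℂ}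
    (hh₀ : IsWeilTest h₀) (hs₀ : tsupport h₀ ⊆ Icc (-a) a) (hq₀ : (weilQuadratic h₀).re < 0) :
    ∃ h : ℝ → ℂ, IsWeilTest h ∧ tsupport h ⊆ Icc (-a) a ∧ (weilQuadratic h).re < 0 ∧
      (weilMellin h (1 / 2)).re ≠ 0 := by
  by_cases hr₀ : (weilMellin h₀ (1 / 2)).re ≠ 0
  · exact ⟨h₀, hh₀, hs₀, hq₀, hr₀⟩
  push Not at hr₀
  obtain ⟨φ, hφ, hφs, hz⟩ := exists_isWeilTest_weilMellin_ne_zero ha (1 / 2)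
  set z : ℂ := weilMellin φ (1 / 2) with hzdef
  -- phase-turn: `φ' = conj z · φ` has `φ̂'(1/2) = |z|² > 0`
  set φ' : ℝ → ℂ := fun x => conj z * φ x with hφ'def
  have hφ' : IsWeilTest φ' := hφ.const_mul (conj z)
  have hφ's : tsupport φ' ⊆ Icc (-a) a := tsupport_mul_subset_right.trans hφs
  have hφ'half : weilMellin φ' (1 / 2) = (Complex.normSq z : ℂ) := by
    rw [hφ'def, weilMellin_const_mul, ← hzdef, Complex.normSq_eq_conj_mul_self]
  have hnz : 0 < Complex.normSq z := Complex.normSq_pos.2 hz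
  -- the line `h₀ + t φ'`
  set q₁ : ℝ := (weilQuadratic φ').re with hq₁
  set ρ : ℝ := (weilFunctional (weilConv h₀ (weilReflect φ')) +
    weilFunctional (weilConv φ' (weilReflect h₀))).re with hρ
  set t : ℝ := min 1 (-(weilQuadratic h₀).re / (2 * (|q₁| + |ρ| + 1))) with htdef
  have hden : 0 < |q₁| + |ρ| + 1 := by positivity
  have htpos : 0 < t := lt_min one_pos (div_pos (by linarith) (by positivity))
  have ht1 : t ≤ 1 := min_le_left _ _
  have ht2 : t ≤ -(weilQuadratic h₀).re / (2 * (|q₁| + |ρ| + 1)) := min_le_right _ _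
  set h : ℝ → ℂ := h₀ + fun x => (t : ℂ) * φ' x with hhdef
  have hh : IsWeilTest h := hh₀.add (hφ'.const_mul t)
  have hhs : tsupport h ⊆ Icc (-a) a :=
    (tsupport_add _ _).trans (union_subset hs₀ (tsupport_mul_subset_right.trans hφ's))
  refine ⟨h, hh, hhs, ?_, ?_⟩
  · -- `Re Q(h) = q₀ + t² q₁ + t ρ ≤ q₀ + t (|q₁| + |ρ|) ≤ q₀ / 2 < 0`
    have hexp : (weilQuadratic h).re = (weilQuadratic h₀).re + t ^ 2 * q₁ + t * ρ := by
      rw [hhdef, re_weilQuadratic_add_real_mul hh₀ hφ' t]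
    have hA : t ^ 2 * q₁ ≤ t * |q₁| := by
      have h1 : t ^ 2 * q₁ ≤ t ^ 2 * |q₁| := mul_le_mul_of_nonneg_left (le_abs_self _) (by positivity)
      have h2 : t ^ 2 * |q₁| ≤ t * |q₁| := by
        have : t ^ 2 ≤ t := by nlinarith
        exact mul_le_mul_of_nonneg_right this (abs_nonneg _)
      linarith
    have hB : t * ρ ≤ t * |ρ| := mul_le_mul_of_nonneg_left (le_abs_self _) htpos.le
    have hC : t * (|q₁| + |ρ| + 1) ≤ -(weilQuadratic h₀).re / 2 := by
      have h2 : t * (2 * (|q₁| + |ρ| + 1)) ≤ -(weilQuadratic h₀).re :=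
        (le_div_iff₀ (by positivity)).1 ht2
      linarith
    have hD : t * (|q₁| + |ρ|) ≤ t * (|q₁| + |ρ| + 1) := by nlinarith
    rw [hexp]
    nlinarith
  · -- `Re ĥ(1/2) = 0 + t |z|² ≠ 0`
    have hM : weilMellin h (1 / 2) = weilMellin h₀ (1 / 2) + (t : ℂ) * (Complex.normSq z : ℂ) := by
      rw [hhdef, weilMellin_add hh₀.1.continuous hh₀.2 (hφ'.const_mul t).1.continuous
        (hφ'.const_mul t).2, weilMellin_const_mul, hφ'half]
    rw [hM, Complex.add_re, hr₀, zero_add]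
    have : ((t : ℂ) * (Complex.normSq z : ℂ)).re = t * Complex.normSq z := by
      rw [← Complex.ofReal_mul, Complex.ofReal_re]
    rw [this]
    exact (mul_pos htpos hnz).ne'

/-- **KEY LEMMA.** If the typed functional is bounded below on the window test functions of
`[-a, a]`, `a > 0` — for ANY shift `λ` — then `ε(a) = weilGroundEnergy a ≥ 0`. (If `ε(a) < 0`,
some unit window test has `Re Q < 0`; perturb it to `Re ĥ(1/2) ≠ 0` and scale by `N → ∞`: the
typed functional collapses to `N² Re Q(h) → −∞`.) [folklore] -/
theorem weilGroundEnergy_nonneg_of_typedLowerBound (ha : 0 < a) {lam m : ℝ}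
    (hm : ∀ h : ℝ → ℂ, IsWeilTest h → tsupport h ⊆ Icc (-a) a →
      m ≤ (weilQuadratic h).re - lam * ∫ t, ‖h t‖ ^ 2 - 2 * (weilMellin h (1 / 2)).re) :
    0 ≤ weilGroundEnergy a := by
  by_contra hneg
  push Not at hneg
  -- a unit-sphere window test with negative energy
  have hne : {x : ℝ | ∃ g : ℝ → ℂ, IsWeilTest g ∧ tsupport g ⊆ Icc (-a) a ∧
      ∫ t : ℝ, ‖g t‖ ^ 2 = 1 ∧ x = (weilQuadratic g).re}.Nonempty := by
    obtain ⟨g, hg, hgs, hgn⟩ := exists_isWeilTest_sphere ha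
    exact ⟨_, g, hg, hgs, hgn, rfl⟩
  obtain ⟨x, ⟨g₀, hg₀, hg₀s, -, rfl⟩, hx⟩ := exists_lt_of_csInf_lt hne hneg
  -- perturb, then scale
  obtain ⟨h, hh, hhs, hq, hr⟩ := exists_re_weilQuadratic_neg_and_re_weilMellin_ne_zero ha hg₀ hg₀s hx
  set q : ℝ := (weilQuadratic h).re with hqdef
  set N : ℝ := (|m| + 1) / (-q) + 1 with hNdef
  have hqneg : 0 < -q := by linarith
  have hN1 : 1 ≤ N := by
    have : 0 ≤ (|m| + 1) / (-q) := div_nonneg (by positivity) hqneg.le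
    linarith
  have hNpos : 0 < N := by linarith
  set H : ℝ → ℂ := fun x => (N : ℂ) * h x with hHdef
  have hH : IsWeilTest H := hh.const_mul N
  have hHs : tsupport H ⊆ Icc (-a) a := tsupport_mul_subset_right.trans hhs
  have hHhalf : (weilMellin H (1 / 2)).re = N * (weilMellin h (1 / 2)).re := by
    rw [hHdef, weilMellin_const_mul, Complex.re_ofReal_mul]
  have hHne : (weilMellin H (1 / 2)).re ≠ 0 := by
    rw [hHhalf]; exact mul_ne_zero hNpos.ne' hr
  have hval : typedJ lam H = N * N * q := by
    rw [typedJ_eq_re_weilQuadratic hH hHne, hHdef, weilQuadratic_const_mul, Complex.normSq_ofReal,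
      Complex.re_ofReal_mul, hqdef]
  have hbound : m ≤ N * N * q := by
    have := hm H hH hHs
    change m ≤ typedJ lam H at this
    rwa [hval] at this
  -- but `N² q ≤ N q ≤ -(|m| + 1) < m`
  have h1 : N * N * q ≤ N * q := by
    nlinarith [mul_nonneg (sub_nonneg.2 hN1) (mul_pos hNpos hqneg).le]
  have h2 : N * (-q) = (|m| + 1) + (-q) := by
    rw [hNdef, add_mul, div_mul_cancel₀ _ hqneg.ne', one_mul]
  have h3 : N * q ≤ -(|m| + 1) := by linarith
  have h4 : -(|m| + 1) < m := by
    have := neg_abs_le m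
    linarith
  linarith

end Key

/-! ## §3 THEOREM A — the typed crux implies RH, the thesis unused -/

/-- **Typed lower bounds along cutoffs `a_k → ∞` give RH.** If along cutoffs `a_k → ∞` (`a_k > 0`)
the typed functional with some shift `λ_k` is bounded below on the window tests of `[-a_k, a_k]`,
then `ε ≥ 0` on `(0, ∞)` (key lemma + `weilGroundEnergy_anti`), i.e. Weil positivity on every
window (`weilGroundEnergy_nonneg_iff_holds`), i.e. the Riemann Hypothesis (Yoshida's criterion from
the discharged Weil criterion, `yoshida_criterion weil_criterion_holds`). [folklore] -/
theorem riemannHypothesis_of_typedLowerBounds {a lam m : ℕ → ℝ} (ha : Tendsto a atTop atTop)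
    (hpos : ∀ k, 0 < a k)
    (hm : ∀ k, ∀ h : ℝ → ℂ, IsWeilTest h → tsupport h ⊆ Icc (-(a k)) (a k) →
      m k ≤ (weilQuadratic h).re - lam k * ∫ t, ‖h t‖ ^ 2 - 2 * (weilMellin h (1 / 2)).re) :
    Summit.RiemannHypothesis := by
  have hε : ∀ k, 0 ≤ weilGroundEnergy (a k) := fun k =>
    weilGroundEnergy_nonneg_of_typedLowerBound (hpos k) (hm k)
  have hW : ∀ b : ℝ, 0 < b → WeilPositivityOn b := fun b hb => by
    obtain ⟨k, hk⟩ := (ha.eventually_ge_atTop b).exists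
    exact (weilGroundEnergy_nonneg_iff_holds hb).1 ((hε k).trans (weilGroundEnergy_anti hb hk))
  exact Summit.RiemannHypothesis_iff.2 ((yoshida_criterion weil_criterion_holds).2 hW)

/-- **THEOREM A (COSTUME, typed decl).** `ResolventConvergence → Summit.RiemannHypothesis`, using of
the crux only `a_k → ∞`, `0 < a_k` and the lower-bound sub-clause of its inline resolvent predicate;
the shift condition, `v_k`, `c_k`, the convergence, the non-vanishing and the `ξ`-clause are
discarded (`-`). Certified `C → S`: the crux as typed is at least the summit. [folklore] -/
theorem riemannHypothesis_of_resolventConvergence (h : ResolventConvergence) :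
    Summit.RiemannHypothesis := by
  obtain ⟨a, lam, v, c, F, ha, hk, -, -, -⟩ := h
  choose m hm using fun k => (hk k).2.2.2.2.choose_spec.2.1
  exact riemannHypothesis_of_typedLowerBounds ha (fun k => (hk k).1) (fun k => (hm k).1)

/-! ## §3b THEOREM A′ (NEGATION side) — the typed crux forces `ε ≡ 0` on a tail

Sharper reading of the typed decl: besides RH it forces the ground energy to VANISH IDENTICALLY on
`[a₀, ∞)`. Reason: on a window with `ε(a) > 0` every TYPED resolvent vector is `0` a.e. (the typed
functional dominates `c ∫|·|²`, `c = ε(a) − max λ 0 > 0`, and vanishes at `0`), so if `ε > 0` on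
the whole ray every `v_k` is `0` a.e., `c_k v̂_k ≡ 0`, and the limit `F` vanishes on `U⁺`,
contradicting the non-vanishing clause. Under RH, `ε(a) > 0` for every `a` is expected in print
(CCM arXiv:2511.22755: discrete spectrum of `A_a` + `Q(h) = Σ_γ |ĥ(1/2+iγ)|²` has no non-zero kernel in
`PW_a`), so the typed crux is, modulo that published input, FALSE — not merely summit-strength. -/

section Tail

variable {a lam : ℝ}

/-- KEY INEQUALITY on a window with an admissible shift `λ < ε(a)`:
`(ε(a) − max λ 0) ∫|h|² ≤ typedJ λ h` for every window test `h` (`weilGroundEnergy_mul_le_re` and the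
collapse `typedJ_eq_re_weilQuadratic`). [folklore] -/
theorem mul_integral_le_typedJ_of_lt (hlam : lam < weilGroundEnergy a) {h : ℝ → ℂ}
    (hh : IsWeilTest h) (hsupp : tsupport h ⊆ Icc (-a) a) :
    (weilGroundEnergy a - max lam 0) * ∫ t, ‖h t‖ ^ 2 ≤ typedJ lam h := by
  have hε := weilGroundEnergy_mul_le_re hh hsupp
  have hN : 0 ≤ ∫ t, ‖h t‖ ^ 2 := integral_nonneg fun t => by positivity
  have hmax0 : 0 ≤ max lam 0 := le_max_right _ _
  have hmaxl : lam ≤ max lam 0 := le_max_left _ _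
  have hml : lam * ∫ t, ‖h t‖ ^ 2 ≤ max lam 0 * ∫ t, ‖h t‖ ^ 2 :=
    mul_le_mul_of_nonneg_right hmaxl hN
  have hm0 : 0 ≤ max lam 0 * ∫ t, ‖h t‖ ^ 2 := mul_nonneg hmax0 hN
  by_cases h0 : (weilMellin h (1 / 2)).re = 0
  · have hJ : typedJ lam h = (weilQuadratic h).re - lam * ∫ t, ‖h t‖ ^ 2 := by
      simp only [typedJ_eq, h0, mul_zero, sub_zero]
    rw [hJ, sub_mul]
    linarith
  · rw [typedJ_eq_re_weilQuadratic hh h0, sub_mul]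
    linarith

/-- **Every TYPED resolvent vector is `0` a.e. on a window with `ε(a) > 0`** (admissible shift
`λ < ε(a)`; cf. `Lines/birth.lean: IsResTyped.integral_norm_sq_eq_zero`, which needed `λ ≤ 0`):
the typed functional is `≥ c ∫|·|²` with `c > 0` and vanishes at `h = 0`, so its infimum `m` is `0`,
the minimising sequence goes to `0` in `L²`, and so does its `L²` limit `v` (Minkowski). [folklore] -/
theorem typed_integral_norm_sq_eq_zero (hε : 0 < weilGroundEnergy a) (hlam : lam < weilGroundEnergy a)
    {v : ℝ → ℂ} (hv2 : MemLp v 2) {g : ℕ → ℝ → ℂ}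
    (hg : ∀ n, IsWeilTest (g n) ∧ tsupport (g n) ⊆ Icc (-a) a) {m : ℝ}
    (hlb : ∀ h : ℝ → ℂ, IsWeilTest h → tsupport h ⊆ Icc (-a) a →
      m ≤ (weilQuadratic h).re - lam * ∫ t, ‖h t‖ ^ 2 - 2 * (weilMellin h (1 / 2)).re)
    (hlim : Tendsto (fun n => (weilQuadratic (g n)).re - lam * ∫ t, ‖g n t‖ ^ 2 -
      2 * (weilMellin (g n) (1 / 2)).re) atTop (𝓝 m))
    (hL2 : Tendsto (fun n => ∫ t, ‖g n t - v t‖ ^ 2) atTop (𝓝 0)) :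
    ∫ t, ‖v t‖ ^ 2 = 0 := by
  set c : ℝ := weilGroundEnergy a - max lam 0 with hcdef
  have hc : 0 < c := by
    rcases le_or_gt lam 0 with hl | hl
    · rw [hcdef, max_eq_right hl]; linarith
    · rw [hcdef, max_eq_left hl.le]; linarith
  have hlim' : Tendsto (fun n => typedJ lam (g n)) atTop (𝓝 m) := hlim
  have hkey : ∀ n, c * ∫ t, ‖g n t‖ ^ 2 ≤ typedJ lam (g n) := fun n =>
    mul_integral_le_typedJ_of_lt hlam (hg n).1 (hg n).2
  have hnn : ∀ n, 0 ≤ c * ∫ t, ‖g n t‖ ^ 2 := fun n =>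
    mul_nonneg hc.le (integral_nonneg fun t => by positivity)
  have hm0 : m ≤ 0 := by
    have hs0 : tsupport (0 : ℝ → ℂ) ⊆ Icc (-a) a := by simp [tsupport_zero]
    have h1 : m ≤ typedJ lam 0 := hlb 0 isWeilTest_zero hs0
    have h2 : typedJ lam 0 = 0 := by simp [typedJ, weilQuadratic_zero, weilMellin_zero]
    rwa [h2] at h1
  have hm1 : 0 ≤ m := ge_of_tendsto' hlim' fun n => (hnn n).trans (hkey n)
  have hm : m = 0 := le_antisymm hm0 hm1
  -- squeeze: `c ∫|gₙ|² → 0`, hence `∫|gₙ|² → 0`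
  have hN : Tendsto (fun n => ∫ t, ‖g n t‖ ^ 2) atTop (𝓝 0) := by
    have h1 : Tendsto (fun n => c * ∫ t, ‖g n t‖ ^ 2) atTop (𝓝 0) :=
      tendsto_of_tendsto_of_tendsto_of_le_of_le tendsto_const_nhds (hm ▸ hlim') hnn hkey
    have h2 := h1.const_mul c⁻¹
    simpa [← mul_assoc, inv_mul_cancel₀ hc.ne'] using h2
  -- Minkowski: `‖v‖₂ ≤ ‖gₙ‖₂ + ‖gₙ − v‖₂ → 0`
  have hmink : ∀ n, Real.sqrt (∫ t, ‖v t‖ ^ 2) ≤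
      Real.sqrt (∫ t, ‖g n t‖ ^ 2) + Real.sqrt (∫ t, ‖g n t - v t‖ ^ 2) := fun n => by
    have hgn : MemLp (g n) 2 := (hg n).1.1.continuous.memLp_of_hasCompactSupport (hg n).1.2
    have h1 := sqrt_integral_norm_sq_sub_le hgn (hgn.sub hv2)
    simpa [Pi.sub_apply, sub_sub_cancel] using h1
  have hlimR : Tendsto (fun n => Real.sqrt (∫ t, ‖g n t‖ ^ 2) +
      Real.sqrt (∫ t, ‖g n t - v t‖ ^ 2)) atTop (𝓝 0) := by
    have h1 := (Real.continuous_sqrt.tendsto 0).comp hN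
    have h2 := (Real.continuous_sqrt.tendsto 0).comp hL2
    simpa using h1.add h2
  have hsqrt : Real.sqrt (∫ t, ‖v t‖ ^ 2) ≤ 0 := ge_of_tendsto' hlimR hmink
  have hle : ∫ t, ‖v t‖ ^ 2 ≤ 0 :=
    Real.sqrt_eq_zero'.1 (le_antisymm hsqrt (Real.sqrt_nonneg _))
  exact le_antisymm hle (integral_nonneg fun t => by positivity)

/-- … hence `v = 0` a.e. and `v̂ ≡ 0`. [folklore] -/
theorem typed_weilMellin_eq_zero (hε : 0 < weilGroundEnergy a) (hlam : lam < weilGroundEnergy a)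
    {v : ℝ → ℂ} (hv2 : MemLp v 2) {g : ℕ → ℝ → ℂ}
    (hg : ∀ n, IsWeilTest (g n) ∧ tsupport (g n) ⊆ Icc (-a) a) {m : ℝ}
    (hlb : ∀ h : ℝ → ℂ, IsWeilTest h → tsupport h ⊆ Icc (-a) a →
      m ≤ (weilQuadratic h).re - lam * ∫ t, ‖h t‖ ^ 2 - 2 * (weilMellin h (1 / 2)).re)
    (hlim : Tendsto (fun n => (weilQuadratic (g n)).re - lam * ∫ t, ‖g n t‖ ^ 2 -
      2 * (weilMellin (g n) (1 / 2)).re) atTop (𝓝 m))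
    (hL2 : Tendsto (fun n => ∫ t, ‖g n t - v t‖ ^ 2) atTop (𝓝 0)) (s : ℂ) :
    weilMellin v s = 0 := by
  have hint : Integrable fun t => ‖v t‖ ^ 2 := (memLp_two_iff_integrable_sq_norm hv2.1).1 hv2
  have h0 := typed_integral_norm_sq_eq_zero hε hlam hv2 hg hlb hlim hL2
  have hae : (fun t => ‖v t‖ ^ 2) =ᵐ[volume] 0 :=
    (integral_eq_zero_iff_of_nonneg (fun t => by positivity) hint).1 h0
  have hv0 : v =ᵐ[volume] 0 := hae.mono fun t ht => by simpa using ht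
  rw [← weilMellin_zero s]
  unfold weilMellin
  exact integral_congr_ae (hv0.mono fun t ht => by simp [ht])

end Tail

/-- **THEOREM A′ (NEGATION side, typed decl).** The typed crux forces the Weil ground energy to
vanish identically on a tail: `ResolventConvergence → ∃ a₀ > 0, ∀ b ≥ a₀, ε(b) = 0` (on top of
Theorem A's `ε ≥ 0` everywhere: if `ε > 0` on the whole ray, every typed `v_k` is `0` a.e.,
`c_k v̂_k ≡ 0` and `F ≡ 0` on `U⁺`, contradicting the crux's non-vanishing clause). [folklore] -/
theorem weilGroundEnergy_eventually_eq_zero_of_resolventConvergence (h : ResolventConvergence) :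
    ∃ a₀ : ℝ, 0 < a₀ ∧ ∀ b : ℝ, a₀ ≤ b → weilGroundEnergy b = 0 := by
  obtain ⟨a, lam, v, c, F, ha, hk, hconv, ⟨s₀, hs₀U, hFs₀⟩, -⟩ := h
  have hε0 : ∀ k, 0 ≤ weilGroundEnergy (a k) := fun k => by
    obtain ⟨hak, -, -, -, g, -, ⟨m, hlb, -⟩, -⟩ := hk k
    exact weilGroundEnergy_nonneg_of_typedLowerBound hak hlb
  have hεb : ∀ b : ℝ, 0 < b → 0 ≤ weilGroundEnergy b := fun b hb => by
    obtain ⟨k, hk'⟩ := (ha.eventually_ge_atTop b).exists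
    exact (hε0 k).trans (weilGroundEnergy_anti hb hk')
  by_contra hcon
  push Not at hcon
  have hpos : ∀ k, 0 < weilGroundEnergy (a k) := fun k => by
    obtain ⟨b, hb, hne⟩ := hcon (a k) (hk k).1
    have hb0 : 0 < b := (hk k).1.trans_le hb
    have h1 : 0 < weilGroundEnergy b := lt_of_le_of_ne (hεb b hb0) (Ne.symm hne)
    exact h1.trans_le (weilGroundEnergy_anti (hk k).1 hb)
  have hzero : ∀ k, c k * weilMellin (v k) s₀ = 0 := fun k => by
    obtain ⟨hak, hlamk, hck, hv2, g, hg, ⟨m, hlb, hlim⟩, hL2⟩ := hk k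
    rw [typed_weilMellin_eq_zero (hpos k) hlamk hv2 hg hlb hlim hL2 s₀, mul_zero]
  have ht : Tendsto (fun k => c k * weilMellin (v k) s₀) atTop (𝓝 (F s₀)) := hconv.tendsto_at hs₀U
  have ht0 : Tendsto (fun k => c k * weilMellin (v k) s₀) atTop (𝓝 0) := by
    simp only [hzero]; exact tendsto_const_nhds
  exact hFs₀ (tendsto_nhds_unique ht ht0)

/-- **COROLLARY (typed decl, both sides).** `ResolventConvergence → RH ∧ (ε ≡ 0 on a tail)`. [folklore] -/
theorem resolventConvergence_typed_forces (h : ResolventConvergence) :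
    Summit.RiemannHypothesis ∧ ∃ a₀ : ℝ, 0 < a₀ ∧ ∀ b : ℝ, a₀ ≤ b → weilGroundEnergy b = 0 :=
  ⟨riemannHypothesis_of_resolventConvergence h,
    weilGroundEnergy_eventually_eq_zero_of_resolventConvergence h⟩

/-! ## §4 THEOREM B — the repaired crux (R1) is `RH ∧ NonCollapse` -/

/-- Repaired crux, restate menu R1 of `MISSTATED.md` (= `Lines/birth.lean: ResolventConvergenceR`,
verbatim): the crux text over the tree's parenthesised predicate `IsWeilResolventVector`. [folklore] -/
def ResolventConvergenceR : Prop :=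
  ∃ (a : ℕ → ℝ) (lam : ℕ → ℝ) (v : ℕ → ℝ → ℂ) (c : ℕ → ℂ) (F : ℂ → ℂ), Tendsto a atTop atTop ∧ (∀ k, 0 < a k ∧ lam k < Literature.NumberTheory.LFunctions.weilGroundEnergy (a k) ∧ c k ≠ 0 ∧ Literature.NumberTheory.LFunctions.IsWeilResolventVector (a k) (lam k) (v k)) ∧ TendstoLocallyUniformlyOn (fun k s => c k * Literature.NumberTheory.LFunctions.weilMellin (v k) s) F atTop {s : ℂ | 1 / 2 < s.re ∧ s.re < 1} ∧ (∃ s : ℂ, (1 / 2 < s.re ∧ s.re < 1) ∧ F s ≠ 0) ∧ (∀ s : ℂ, 1 / 2 < s.re → s.re < 1 → Literature.NumberTheory.LFunctions.riemannXi s = 0 → F s = 0)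

/-- Repaired sibling crux (R1 of `MISSTATED.md`, = `RestateR1Check.lean: ResolventRealZeros`). [folklore] -/
def ResolventRealZerosR : Prop :=
  ∀ a : ℝ, 0 < a → ∀ lam : ℝ, lam < Literature.NumberTheory.LFunctions.weilGroundEnergy a → ∀ v : ℝ → ℂ, Literature.NumberTheory.LFunctions.IsWeilResolventVector a lam v → Differentiable ℂ (Literature.NumberTheory.LFunctions.weilMellin v) ∧ ∀ s : ℂ, Literature.NumberTheory.LFunctions.weilMellin v s = 0 → s.re = 1 / 2

/-- **NON-COLLAPSE** = the repaired crux with its `ξ`-vanishing clause deleted: along some admissible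
sequence the normalised transforms converge locally uniformly on `U⁺` to a limit not identically
zero there. An OPEN statement of unknown status: conjectural in print even under RH
(CCM arXiv:2511.22755 (1.2); Suzuki arXiv:2606.09096 Cor. 1.6 hypothesis; 2001 swrh App. A unpublished). [folklore] -/
def NonCollapseR : Prop :=
  ∃ (a : ℕ → ℝ) (lam : ℕ → ℝ) (v : ℕ → ℝ → ℂ) (c : ℕ → ℂ) (F : ℂ → ℂ), Tendsto a atTop atTop ∧ (∀ k, 0 < a k ∧ lam k < Literature.NumberTheory.LFunctions.weilGroundEnergy (a k) ∧ c k ≠ 0 ∧ Literature.NumberTheory.LFunctions.IsWeilResolventVector (a k) (lam k) (v k)) ∧ TendstoLocallyUniformlyOn (fun k s => c k * Literature.NumberTheory.LFunctions.weilMellin (v k) s) F atTop {s : ℂ | 1 / 2 < s.re ∧ s.re < 1} ∧ (∃ s : ℂ, (1 / 2 < s.re ∧ s.re < 1) ∧ F s ≠ 0)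

/-- The repaired crux trivially contains NON-COLLAPSE (drop the last clause). [folklore] -/
theorem nonCollapseR_of_resolventConvergenceR (h : ResolventConvergenceR) : NonCollapseR := by
  obtain ⟨a, lam, v, c, F, ha, hk, hconv, hnz, -⟩ := h
  exact ⟨a, lam, v, c, F, ha, hk, hconv, hnz⟩

/-- Under RH, `ξ` has no zero in `U⁺ = {1/2 < Re s < 1}` (`riemannXi_eq_zero_iff_holds` + Mathlib's
`RiemannHypothesis`). [folklore] -/
theorem riemannXi_ne_zero_of_riemannHypothesis (hRH : Summit.RiemannHypothesis) {s : ℂ}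
    (h1 : 1 / 2 < s.re) (h2 : s.re < 1) : riemannXi s ≠ 0 := by
  intro hxi
  obtain ⟨hzeta, h0, -⟩ := (riemannXi_eq_zero_iff_holds s).1 hxi
  have htriv : ¬ ∃ n : ℕ, s = -2 * (n + 1) := by
    rintro ⟨n, rfl⟩
    have : ((-2 : ℂ) * (n + 1)).re = -2 * (n + 1) := by simp
    rw [this] at h0
    have hn : (0 : ℝ) ≤ n := Nat.cast_nonneg n
    linarith
  have hone : s ≠ 1 := by
    rintro rfl
    simp at h2
  have := (Summit.RiemannHypothesis_iff.1 hRH) s hzeta htriv hone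
  linarith

/-- **Under RH the `ξ`-clause is vacuous**: `RH → (NonCollapseR → ResolventConvergenceR)`. [folklore] -/
theorem resolventConvergenceR_of_riemannHypothesis (hRH : Summit.RiemannHypothesis)
    (h : NonCollapseR) : ResolventConvergenceR := by
  obtain ⟨a, lam, v, c, F, ha, hk, hconv, hnz⟩ := h
  exact ⟨a, lam, v, c, F, ha, hk, hconv, hnz,
    fun s h1 h2 hxi => absurd hxi (riemannXi_ne_zero_of_riemannHypothesis hRH h1 h2)⟩

/-- **Without RH the `ξ`-clause IS RH**: `ResolventRealZerosR → ResolventConvergenceR → RH` — the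
route's deciding theorem `closes`, proof script verbatim (cf. `RestateR1Check.lean`). [folklore] -/
theorem riemannHypothesis_of_resolventConvergenceR (h₃ : ResolventRealZerosR)
    (h₂ : ResolventConvergenceR) : Summit.RiemannHypothesis := by
  classical
  obtain ⟨a, lam, v, c, F, -, hk, hlim, ⟨s₀, hs₀U, hFs₀⟩, hvan⟩ := h₂
  have hF : ∀ k, Differentiable ℂ
      (fun s => c k * _root_.Literature.NumberTheory.LFunctions.weilMellin (v k) s) ∧
      ∀ s, c k * _root_.Literature.NumberTheory.LFunctions.weilMellin (v k) s = 0 → s.re = 1 / 2 := by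
    intro k
    obtain ⟨hak, hlamk, hck, hres⟩ := hk k
    obtain ⟨hdiff, hzero⟩ := h₃ (a k) hak (lam k) hlamk (v k) hres
    refine ⟨(differentiable_const (c k)).mul hdiff, fun s hs => hzero s ?_⟩
    rcases mul_eq_zero.1 hs with h | h
    · exact absurd h hck
    · exact h
  set U : Set ℂ := {s : ℂ | 1 / 2 < s.re ∧ s.re < 1} with hUdef
  have hUo : IsOpen U :=
    (isOpen_lt continuous_const Complex.continuous_re).inter (isOpen_lt Complex.continuous_re continuous_const)
  have hUc : Convex ℝ U := (convex_halfSpace_re_gt (1 / 2)).inter (convex_halfSpace_re_lt 1)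
  have hFd : ∀ᶠ k in Filter.atTop, DifferentiableOn ℂ
      (fun s => c k * _root_.Literature.NumberTheory.LFunctions.weilMellin (v k) s) U :=
    Filter.Eventually.of_forall fun k => (hF k).1.differentiableOn
  have hFne : ∃ᶠ k in Filter.atTop, ∀ z ∈ U,
      c k * _root_.Literature.NumberTheory.LFunctions.weilMellin (v k) z ≠ 0 :=
    Filter.Frequently.of_forall fun k z hz hz0 => by
      have := (hF k).2 z hz0
      linarith [hz.1]
  rcases Complex.hurwitz_eqOn_zero_or_forall_ne_zero hUo hUc.isPreconnected hFd hlim hFne with hzero | hne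
  · exact absurd (hzero hs₀U) hFs₀
  · show _root_.RiemannHypothesis
    intro s hzeta htriv hone
    have hxi := _root_.Literature.NumberTheory.LFunctions.riemannXi_eq_zero_of_nontrivial hzeta htriv hone
    obtain ⟨-, h0, h1⟩ := (_root_.Literature.NumberTheory.LFunctions.riemannXi_eq_zero_iff_holds s).1 hxi
    by_contra hne'
    rcases lt_or_gt_of_ne hne' with hlt | hgt
    · have h1s : (1 - s) ∈ U := by
        refine ⟨?_, ?_⟩
        · simp only [Complex.sub_re, Complex.one_re]; linarith
        · simp only [Complex.sub_re, Complex.one_re]; linarith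
      have hx1 : _root_.Literature.NumberTheory.LFunctions.riemannXi (1 - s) = 0 :=
        (_root_.Literature.NumberTheory.LFunctions.riemannXi_one_sub s).trans hxi
      exact hne (1 - s) h1s (hvan (1 - s) h1s.1 h1s.2 hx1)
    · exact hne s ⟨hgt, h1⟩ (hvan s hgt h1 hxi)

/-- **THEOREM B (COSTUME, repaired decl).** Given the sibling crux (real-rootedness at every cutoff,
expected unconditional: Suzuki 2026 Thm 1.5 analogue), the repaired crux is EXACTLY
`RH ∧ NonCollapseR`: a conjunction of the summit with an open side statement; the `ξ`-vanishing
clause contributes precisely the bit "RH". [folklore] -/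
theorem resolventConvergenceR_iff (h₃ : ResolventRealZerosR) :
    ResolventConvergenceR ↔ (Summit.RiemannHypothesis ∧ NonCollapseR) :=
  ⟨fun h => ⟨riemannHypothesis_of_resolventConvergenceR h₃ h, nonCollapseR_of_resolventConvergenceR h⟩,
    fun h => resolventConvergenceR_of_riemannHypothesis h.1 h.2⟩

/-- Unconditional half of Theorem B: `RH → (ResolventConvergenceR ↔ NonCollapseR)` — on the RH side
the crux IS non-collapse and says nothing about zeros. [folklore] -/
theorem resolventConvergenceR_iff_nonCollapseR_of_riemannHypothesis (hRH : Summit.RiemannHypothesis) :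
    ResolventConvergenceR ↔ NonCollapseR :=
  ⟨nonCollapseR_of_resolventConvergenceR, resolventConvergenceR_of_riemannHypothesis hRH⟩

end Summit.RiemannHypothesis.RiemannHypothesis.Cruxes.ResolventConvergence.Costume

end
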